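import Literature.AnabelianGeometry.EtaleTheta.KummerFunctorialityCovariant
import Literature.AnabelianGeometry.EtaleTheta.TorsorSystems
import HarnessLib

/-!
# Non-vacuity of `EquivariantMorphism` and `TObj.Hom` (L2 inhabitation census)

Mochizuki, *Topics in absolute anabelian geometry III*, J. Math. Sci. Univ. Tokyo **22** (2015),
Def. 3.1 (ii) p. 67 (morphisms of pairs `(Π₁ ↷ M₁) → (Π₂ ↷ M₂)`), and *The étale theta function …*,
Publ. RIMS **45** (2009) [EtTh], Prop. 2.15 p. 52 (the category `𝒯` of `ℤ`-torsors `T_M`).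
[cite: MochizukiAbsTopIII2015, Definition 3.1 (ii) p.67] [cite: MochizukiEtTh2009, Prop 2.15 p.52]

PROOF-ONLY companion (abc-iut cell; writer abc-iut-w6-d050, an L3 seat serving the L2 NODES NV column by
signature).  abc-iut-w5-d197's kernel INHABITATION-CENSUS-L2 v5 (09:45Z) lists, among its 15 structures
with ZERO named producers, the two that are NOT tied to a theta setting: the covariant equivariant morphisms
of pairs `EquivariantMorphism G₁ A₁ G₂ A₂` (`KummerFunctorialityCovariant.lean`) and the hom-structure
`TObj.Hom` of the category `𝒯` (`TorsorSystems.lean`; its inhabitants in the tree are the `Category TObj`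
instance fields and `A ⟶ B`-typed terms, invisible to a by-name scan).  Below: NAMED witnesses typed with
the structure names — for `EquivariantMorphism` the identity pair, the `n`-th power morphism, the trivial
morphism along ANY group homomorphism (so the structure is inhabited at EVERY quadruple
`(G₁, A₁, G₂, A₂)`) and composition; for `TObj.Hom` the exact existence criterion
`Nonempty (TObj.Hom A B) ↔ B.idx ∣ A.idx` (canonical projection `T_{M'} → T_M`; empty hom-sets otherwise),
the identity, and the translation by `M` as a NON-identity endomorphism of `T_M`.  No `def`, no
`instance`, no new named fact; nothing here bears on [IUTchIII] Cor. 3.12.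
-/

namespace Literature.AnabelianGeometry.EtaleTheta

open CategoryTheory

/-! ### §1 `EquivariantMorphism` ([AbsTopIII] Def. 3.1 (ii): `(φ, ψ) : (G₁ ↷ A₁) → (G₂ ↷ A₂)`) -/

namespace EquivariantMorphism

universe u₁ u₂ u₃ u₄ u₅ u₆

variable {G₁ : Type u₁} {A₁ : Type u₂} {G₂ : Type u₃} {A₂ : Type u₄} {G₃ : Type u₅} {A₃ : Type u₆}
  [Group G₁] [CommGroup A₁] [MulDistribMulAction G₁ A₁] [Group G₂] [CommGroup A₂]
  [MulDistribMulAction G₂ A₂] [Group G₃] [CommGroup A₃] [MulDistribMulAction G₃ A₃]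

/-- **The identity pair** `(id, id) : (G ↷ A) → (G ↷ A)` is an equivariant morphism.
[cite: MochizukiAbsTopIII2015, Definition 3.1 (ii) p.67] -/
theorem nonempty_self (G : Type u₁) (A : Type u₂) [Group G] [CommGroup A] [MulDistribMulAction G A] :
    Nonempty (EquivariantMorphism G A G A) :=
  ⟨{ groupHom := MonoidHom.id G
     map := MonoidHom.id A
     map_smul := fun _ _ => rfl }⟩

/-- **The `n`-th power morphism** `(id, a ↦ aⁿ) : (G ↷ A) → (G ↷ A)` (equivariant because the action is
by group automorphisms) — a NON-identity witness whenever `A` has an element of order not dividing `n - 1`.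
[cite: MochizukiAbsTopIII2015, Definition 3.1 (ii) p.67] -/
theorem exists_pow (G : Type u₁) (A : Type u₂) [Group G] [CommGroup A] [MulDistribMulAction G A]
    (n : ℕ) : ∃ c : EquivariantMorphism G A G A,
      c.groupHom = MonoidHom.id G ∧ ∀ a : A, c.map a = a ^ n :=
  ⟨{ groupHom := MonoidHom.id G
     map := powMonoidHom n
     map_smul := fun g a => by simp }, rfl, fun _ => rfl⟩

/-- **The trivial morphism along any `φ`**: `(φ, 1) : (G₁ ↷ A₁) → (G₂ ↷ A₂)`.  Hence
`EquivariantMorphism G₁ A₁ G₂ A₂` is inhabited at EVERY quadruple, with prescribed group component.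
[cite: MochizukiAbsTopIII2015, Definition 3.1 (ii) p.67] -/
theorem exists_groupHom_eq (φ : G₁ →* G₂) :
    ∃ c : EquivariantMorphism G₁ A₁ G₂ A₂, c.groupHom = φ ∧ c.map = 1 :=
  ⟨{ groupHom := φ
     map := 1
     map_smul := fun g a => by simp }, rfl, rfl⟩

/-- `EquivariantMorphism G₁ A₁ G₂ A₂` is inhabited for all `G₁, A₁, G₂, A₂` (the trivial morphism along
the trivial homomorphism). [cite: MochizukiAbsTopIII2015, Definition 3.1 (ii) p.67] -/
theorem nonempty (G₁ : Type u₁) (A₁ : Type u₂) (G₂ : Type u₃) (A₂ : Type u₄) [Group G₁] [CommGroup A₁]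
    [MulDistribMulAction G₁ A₁] [Group G₂] [CommGroup A₂] [MulDistribMulAction G₂ A₂] :
    Nonempty (EquivariantMorphism G₁ A₁ G₂ A₂) := by
  obtain ⟨c, -, -⟩ := exists_groupHom_eq (A₁ := A₁) (A₂ := A₂) (1 : G₁ →* G₂)
  exact ⟨c⟩

/-- **Composition** of equivariant morphisms of pairs: `(φ', ψ') ∘ (φ, ψ) = (φ' ∘ φ, ψ' ∘ ψ)`.
[cite: MochizukiAbsTopIII2015, Definition 3.1 (ii) p.67] -/
theorem exists_comp (c : EquivariantMorphism G₁ A₁ G₂ A₂) (c' : EquivariantMorphism G₂ A₂ G₃ A₃) :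
    ∃ d : EquivariantMorphism G₁ A₁ G₃ A₃,
      d.groupHom = c'.groupHom.comp c.groupHom ∧ d.map = c'.map.comp c.map :=
  ⟨{ groupHom := c'.groupHom.comp c.groupHom
     map := c'.map.comp c.map
     map_smul := fun g a => by simp [c.map_smul, c'.map_smul] }, rfl, rfl⟩

/-- Restriction to a subgroup along the inclusion: `(H.subtype, id) : (H ↷ A) → (G ↷ A)`.
[cite: MochizukiAbsTopIII2015, Definition 3.1 (ii) p.67] -/
theorem exists_subtype (H : Subgroup G₁) :
    ∃ c : EquivariantMorphism H A₁ G₁ A₁, c.groupHom = H.subtype ∧ c.map = MonoidHom.id A₁ :=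
  ⟨{ groupHom := H.subtype
     map := MonoidHom.id A₁
     map_smul := fun _ _ => rfl }, rfl, rfl⟩

end EquivariantMorphism

/-! ### §2 `TObj.Hom` ([EtTh] Prop. 2.15: morphisms `T_{M'} → T_M` of `𝒯`, defined iff `M ∣ M'`) -/

namespace TObj

/-- **The canonical projection** `T_{M'} → T_M` (shift `0`) exists exactly when `M ∣ M'`; otherwise the
hom-set is empty.  [cite: MochizukiEtTh2009, Prop 2.15 p.52] -/
theorem Hom.nonempty_iff (A B : TObj) : Nonempty (Hom A B) ↔ (B.idx : ℤ) ∣ (A.idx : ℤ) :=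
  ⟨fun ⟨f⟩ => f.dvd, fun h => ⟨⟨0, h, dvd_zero _⟩⟩⟩

/-- The canonical projection `T_{M'} → T_M` for `M ∣ M'`, with shift `0`.
[cite: MochizukiEtTh2009, Prop 2.15 p.52] -/
theorem Hom.exists_shift_zero {A B : TObj} (h : (B.idx : ℤ) ∣ (A.idx : ℤ)) :
    ∃ f : Hom A B, f.shift = 0 :=
  ⟨⟨0, h, dvd_zero _⟩, rfl⟩

/-- `Hom` is inhabited at every object: the identity of `T_M`, typed by name.
[cite: MochizukiEtTh2009, Prop 2.15 p.52] -/
theorem Hom.nonempty_self (A : TObj) : Nonempty (Hom A A) :=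
  ⟨𝟙 A⟩

/-- Every arrow `A ⟶ B` of `𝒯` is a `TObj.Hom A B` (bridge for by-name scans).
[cite: MochizukiEtTh2009, Prop 2.15 p.52] -/
theorem Hom.nonempty_of_hom {A B : TObj} (f : A ⟶ B) : Nonempty (Hom A B) :=
  ⟨f⟩

/-- **A non-identity endomorphism**: the translation of `T_M` by `M` (an automorphism, [EtTh]
Prop. 2.15 (i): `Aut(T_M) = M·ℤ`). [cite: MochizukiEtTh2009, Prop 2.15(i) p.52] -/
theorem Hom.exists_shift_eq_idx (A : TObj) : ∃ f : Hom A A, f.shift = A.idx ∧ f ≠ 𝟙 A := by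
  refine ⟨⟨A.idx, dvd_rfl, dvd_rfl⟩, rfl, fun h => ?_⟩
  have h' := congrArg Hom.shift h
  change ((A.idx : ℕ) : ℤ) = 0 at h'
  exact absurd h' (by exact_mod_cast A.idx.ne_zero)

/-- The hom-set `T_{M'} → T_M` is EMPTY when `M ∤ M'` (e.g. `T_1 → T_2`).
[cite: MochizukiEtTh2009, Prop 2.15 p.52] -/
theorem Hom.isEmpty_of_not_dvd {A B : TObj} (h : ¬ (B.idx : ℤ) ∣ (A.idx : ℤ)) : IsEmpty (Hom A B) :=
  ⟨fun f => h f.dvd⟩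

/-- Concretely: there is no morphism `T_1 → T_2`, but there is one `T_2 → T_1`.
[cite: MochizukiEtTh2009, Prop 2.15 p.52] -/
theorem Hom.isEmpty_one_two_and_nonempty_two_one :
    IsEmpty (Hom ⟨1⟩ ⟨2⟩) ∧ Nonempty (Hom ⟨2⟩ ⟨1⟩) :=
  ⟨Hom.isEmpty_of_not_dvd (by decide), (Hom.nonempty_iff _ _).2 (by decide)⟩

/-- For `M ∣ M'` the morphisms `T_{M'} → T_M` are exactly the translations by `M·ℤ`: the hom-set is in
bijection with `{k : ℤ // M ∣ k}` via the shift. [cite: MochizukiEtTh2009, Prop 2.15 p.52] -/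
theorem Hom.exists_equiv_shift {A B : TObj} (h : (B.idx : ℤ) ∣ (A.idx : ℤ)) :
    ∃ e : Hom A B ≃ {k : ℤ // (B.idx : ℤ) ∣ k}, ∀ f, (e f : ℤ) = f.shift :=
  ⟨{ toFun := fun f => ⟨f.shift, f.mem⟩
     invFun := fun k => ⟨k.1, h, k.2⟩
     left_inv := fun f => by ext; rfl
     right_inv := fun k => by simp }, fun _ => rfl⟩

end TObj

end Literature.AnabelianGeometry.EtaleTheta
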